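import Summits.Ventures.PercRepro.PurePairGraphBot

/-!
# The pure-pair gadget — Lemma (B′): the explicit clusters (graph half, module 2b)

Under `Local`, the candidate clusters `K ω m` and `XR ω` have CLOSED boundaries — checked over the
eight kinds of edges (`c – x`; the hubs' `x`- and mark edges; the pair's `u–v`, `x–u`, `x–v`,
`c–u`, `c–v`) — so `bot ⟺ Local` (`isBot_iff`), `cluster ω (vm m) = K ω m` (`cluster_mark_eq`) and,
when `x` attaches to no mark, `cluster ω vx = XR ω` (`cluster_x_eq`).
-/

namespace PercRepro.PurePairGraph

open MultiGraph StarGadgetGraph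

variable {p q r s n : ℕ}

/-! ### The closed boundaries -/

/-- Under `Local`, `x` attaches to a mark `m` only if `m = c`, whenever `x` is joined to `c`
otherwise than through a hub. -/
theorem eq_two_of_att_of_cxjoin {ω : Config (PE p q r s n)} (hL : Local ω)
    (hj : cxOpen ω ∨ ∃ j, xcPath (pairState ω j)) {m : Fin 3} (hA : Att ω m) : m = 2 := by
  rcases hA with ⟨rfl, -⟩ | ⟨h, hx, hm⟩
  · rfl
  · exact hL.2.2 hj h m hx hm

/-- Under `Local`, no open edge crosses the boundary of `K ω m`. -/
theorem K_closed {ω : Config (PE p q r s n)} (hL : Local ω) (m : Fin 3) :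
    ∀ e, ω e = true →
      ((purePairGadget p q r s n).fst e ∈ K ω m ↔ (purePairGadget p q r s n).snd e ∈ K ω m) := by
  obtain ⟨hL1, hL2, hL3⟩ := hL
  intro e he
  rcases e with k | ⟨b, j⟩
  · -- the edge `c – x`
    have hc : cxOpen ω := by
      have : k = 0 := Subsingleton.elim _ _
      subst this; exact he
    show (vm 2 : PV p q r s n) ∈ K ω m ↔ vx ∈ K ω m
    rw [vm_mem_K_iff, vx_mem_K_iff]
    constructor
    · rintro rfl
      exact Or.inl ⟨rfl, Or.inl hc⟩
    · intro hA
      exact (eq_two_of_att_of_cxjoin ⟨hL1, hL2, hL3⟩ (Or.inl hc) hA).symm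
  · rcases b with h | j'
    · rcases j with _ | i
      · -- the edge `x – h`
        have hx : xOpen ω h := he
        show (vx : PV p q r s n) ∈ K ω m ↔ hv h ∈ K ω m
        rw [vx_mem_K_iff, hv_mem_K_iff]
        constructor
        · intro hA
          exact Or.inr ⟨hA, hx⟩
        · rintro (⟨hnx, -⟩ | ⟨hA, -⟩)
          · exact absurd hx hnx
          · exact hA
      · -- the edge `m'' – h`
        have hm'' : markOpen ω h ((hubType h).marks.get i) := ⟨i, rfl, he⟩
        show (vm ((hubType h).marks.get i) : PV p q r s n) ∈ K ω m ↔ hv h ∈ K ω m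
        rw [vm_mem_K_iff, hv_mem_K_iff]
        constructor
        · rintro rfl
          by_cases hx : xOpen ω h
          · exact Or.inr ⟨Or.inr ⟨h, hx, hm''⟩, hx⟩
          · exact Or.inl ⟨hx, hm''⟩
        · rintro (⟨-, hm⟩ | ⟨hA, hx⟩)
          · exact hL1 h _ _ hm'' hm
          · rcases hA with ⟨rfl, hj⟩ | ⟨h', hx', hm'⟩
            · exact hL3 hj h _ hx hm''
            · exact hL2 h h' _ _ hx hx' hm'' hm'
    · -- the edges of the pair `j'`
      fin_cases j
      · -- `u – v`
        have huv : puv (pairState ω j') := he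
        show (pv j' false : PV p q r s n) ∈ K ω m ↔ pv j' true ∈ K ω m
        rw [pv_mem_K_iff, pv_mem_K_iff]
        have e1 := catt_swap huv false
        have e2 := xatt_swap huv false
        simp only [Bool.not_false] at e1 e2
        rw [e1, e2]
      · -- `x – u`
        have hx : pxo (pairState ω j') false := he
        show (vx : PV p q r s n) ∈ K ω m ↔ pv j' false ∈ K ω m
        rw [vx_mem_K_iff, pv_mem_K_iff]
        constructor
        · intro hA
          exact Or.inr ⟨hA, xatt_of_pxo hx⟩
        · rintro (⟨rfl, hc⟩ | ⟨hA, -⟩)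
          · exact Or.inl ⟨rfl, Or.inr ⟨j', false, hx, hc⟩⟩
          · exact hA
      · -- `x – v`
        have hx : pxo (pairState ω j') true := he
        show (vx : PV p q r s n) ∈ K ω m ↔ pv j' true ∈ K ω m
        rw [vx_mem_K_iff, pv_mem_K_iff]
        constructor
        · intro hA
          exact Or.inr ⟨hA, xatt_of_pxo hx⟩
        · rintro (⟨rfl, hc⟩ | ⟨hA, -⟩)
          · exact Or.inl ⟨rfl, Or.inr ⟨j', true, hx, hc⟩⟩
          · exact hA
      · -- `c – u`
        have hc : pco (pairState ω j') false := he
        show (vm 2 : PV p q r s n) ∈ K ω m ↔ pv j' false ∈ K ω m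
        rw [vm_mem_K_iff, pv_mem_K_iff]
        constructor
        · rintro rfl
          exact Or.inl ⟨rfl, catt_of_pco hc⟩
        · rintro (⟨rfl, -⟩ | ⟨hA, hx⟩)
          · rfl
          · exact (eq_two_of_att_of_cxjoin ⟨hL1, hL2, hL3⟩
              (Or.inr ⟨j', xcPath_of_xatt_catt hx (catt_of_pco hc)⟩) hA).symm
      · -- `c – v`
        have hc : pco (pairState ω j') true := he
        show (vm 2 : PV p q r s n) ∈ K ω m ↔ pv j' true ∈ K ω m
        rw [vm_mem_K_iff, pv_mem_K_iff]
        constructor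
        · rintro rfl
          exact Or.inl ⟨rfl, catt_of_pco hc⟩
        · rintro (⟨rfl, -⟩ | ⟨hA, hx⟩)
          · rfl
          · exact (eq_two_of_att_of_cxjoin ⟨hL1, hL2, hL3⟩
              (Or.inr ⟨j', xcPath_of_xatt_catt hx (catt_of_pco hc)⟩) hA).symm

/-- When `x` attaches to no mark, no open edge crosses the boundary of `XR ω`. -/
theorem XR_closed {ω : Config (PE p q r s n)} (hR : ∀ m, ¬ Att ω m) :
    ∀ e, ω e = true →
      ((purePairGadget p q r s n).fst e ∈ XR ω ↔ (purePairGadget p q r s n).snd e ∈ XR ω) := by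
  intro e he
  rcases e with k | ⟨b, j⟩
  · have hc : cxOpen ω := by
      have : k = 0 := Subsingleton.elim _ _
      subst this; exact he
    exact absurd (show Att ω 2 from Or.inl ⟨rfl, Or.inl hc⟩) (hR 2)
  · rcases b with h | j'
    · rcases j with _ | i
      · have hx : xOpen ω h := he
        show (vx : PV p q r s n) ∈ XR ω ↔ hv h ∈ XR ω
        rw [hv_mem_XR_iff]
        exact ⟨fun _ => hx, fun _ => vx_mem_XR⟩
      · have hm : markOpen ω h ((hubType h).marks.get i) := ⟨i, rfl, he⟩
        show (vm ((hubType h).marks.get i) : PV p q r s n) ∈ XR ω ↔ hv h ∈ XR ω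
        rw [hv_mem_XR_iff]
        constructor
        · intro h1
          exact absurd h1 (vm_not_mem_XR _)
        · intro hx
          exact absurd (show Att ω _ from Or.inr ⟨h, hx, hm⟩) (hR _)
    · fin_cases j
      · have huv : puv (pairState ω j') := he
        show (pv j' false : PV p q r s n) ∈ XR ω ↔ pv j' true ∈ XR ω
        rw [pv_mem_XR_iff, pv_mem_XR_iff]
        have e2 := xatt_swap huv false
        simp only [Bool.not_false] at e2
        rw [e2]
      · have hx : pxo (pairState ω j') false := he
        show (vx : PV p q r s n) ∈ XR ω ↔ pv j' false ∈ XR ω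
        rw [pv_mem_XR_iff]
        exact ⟨fun _ => xatt_of_pxo hx, fun _ => vx_mem_XR⟩
      · have hx : pxo (pairState ω j') true := he
        show (vx : PV p q r s n) ∈ XR ω ↔ pv j' true ∈ XR ω
        rw [pv_mem_XR_iff]
        exact ⟨fun _ => xatt_of_pxo hx, fun _ => vx_mem_XR⟩
      · have hc : pco (pairState ω j') false := he
        show (vm 2 : PV p q r s n) ∈ XR ω ↔ pv j' false ∈ XR ω
        rw [pv_mem_XR_iff]
        constructor
        · intro h1
          exact absurd h1 (vm_not_mem_XR _)
        · intro hx
          exact absurd (show Att ω 2 from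
            Or.inl ⟨rfl, Or.inr ⟨j', xcPath_of_xatt_catt hx (catt_of_pco hc)⟩⟩) (hR 2)
      · have hc : pco (pairState ω j') true := he
        show (vm 2 : PV p q r s n) ∈ XR ω ↔ pv j' true ∈ XR ω
        rw [pv_mem_XR_iff]
        constructor
        · intro h1
          exact absurd h1 (vm_not_mem_XR _)
        · intro hx
          exact absurd (show Att ω 2 from
            Or.inl ⟨rfl, Or.inr ⟨j', xcPath_of_xatt_catt hx (catt_of_pco hc)⟩⟩) (hR 2)

/-! ### Lemma (B′) -/

/-- Under `Local`, two distinct marks are disconnected. -/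
theorem not_conn_vm_of_local {ω : Config (PE p q r s n)} (hL : Local ω) {m m' : Fin 3}
    (hne : m ≠ m') : ¬ (purePairGadget p q r s n).Conn ω (vm m) (vm m') := by
  intro hconn
  have hmem : (vm m' : PV p q r s n) ∈ K ω m :=
    mem_of_conn_of_closed_boundary (K_closed hL m) (vm_mem_K_iff.2 rfl) hconn
  exact hne (vm_mem_K_iff.1 hmem).symm

/-- **Lemma (B′), first half**: `bot` is the local condition. -/
theorem isBot_iff (ω : Config (PE p q r s n)) :
    (purePairGadget p q r s n).IsBot ω (vm 0) (vm 1) (vm 2) ↔ Local ω :=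
  ⟨local_of_isBot, fun hL =>
    ⟨not_conn_vm_of_local hL (by decide), not_conn_vm_of_local hL (by decide),
      not_conn_vm_of_local hL (by decide)⟩⟩

/-- **Lemma (B′), the clusters of the marks**: under `Local`, the open cluster of the mark `m` is
`K ω m`. -/
theorem cluster_mark_eq (ω : Config (PE p q r s n)) (hL : Local ω) (m : Fin 3) :
    (purePairGadget p q r s n).cluster ω (vm m) = K ω m := by
  ext u
  constructor
  · intro hu
    exact mem_of_conn_of_closed_boundary (K_closed hL m) (vm_mem_K_iff.2 rfl) hu
  · intro hu
    rw [mem_K_iff] at hu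
    rcases hu with ((rfl | ⟨h, rfl, -, hm⟩) | ⟨rfl, j, w, rfl, hc⟩) |
      ⟨hA, rfl | ⟨h, rfl, hx⟩ | ⟨j, w, rfl, hx⟩⟩
    · exact Conn.refl (purePairGadget p q r s n) ω _
    · exact conn_vm_hv_of_markOpen hm
    · exact conn_c_pv_of_catt hc
    · exact conn_vm_vx_of_att hA
    · exact (conn_vm_vx_of_att hA).trans (conn_vx_hv_of_xOpen hx)
    · exact (conn_vm_vx_of_att hA).trans (conn_vx_pv_of_xatt hx)

/-- **Lemma (B′), the cluster of the centre in mode R**: when `x` attaches to no mark, its open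
cluster is `XR ω`. -/
theorem cluster_x_eq (ω : Config (PE p q r s n)) (hR : ∀ m, ¬ Att ω m) :
    (purePairGadget p q r s n).cluster ω vx = XR ω := by
  ext u
  constructor
  · intro hu
    exact mem_of_conn_of_closed_boundary (XR_closed hR) vx_mem_XR hu
  · intro hu
    rw [mem_XR_iff] at hu
    rcases hu with (rfl | ⟨h, rfl, hx⟩) | ⟨j, w, rfl, hx⟩
    · exact Conn.refl (purePairGadget p q r s n) ω _
    · exact conn_vx_hv_of_xOpen hx
    · exact conn_vx_pv_of_xatt hx

/-- The centre lies in the cluster of `m` iff `x` attaches to `m` (under `Local`). -/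
theorem vx_mem_cluster_mark_iff (ω : Config (PE p q r s n)) (hL : Local ω) (m : Fin 3) :
    vx ∈ (purePairGadget p q r s n).cluster ω (vm m) ↔ Att ω m := by
  rw [cluster_mark_eq ω hL m, vx_mem_K_iff]

end PercRepro.PurePairGraph
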